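import Literature.NumberTheory.EllipticCurves.NeronComponentIndexTypeIVstarProofs
import Literature.NumberTheory.DiophantineGeometry.TateAlgorithmRingEquivProofs
import Summits.BirchSwinnertonDyer.BirchSwinnertonDyer.Theorems.ManinLocalTwoThreeTameCellIVstarPadicNormalForm
import HarnessLib

/-!
# The Tate `IV*`-normal form (residue characteristic `2`) and E-imc-75 as a THEOREM

Summit `BirchSwinnertonDyer`, route `ManinLocalTwoThree` (cell bsd-f2-manin), crux C2 `ManinOddAtFour`
(stmt-BirchSwinnertonDyer-22967), tame cell, law E-imc-75 `TameTwoLocal.TameCellAtMostOneLocalTwoTorsionPoint` (typer p630862,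
census 215 648 / 215 648).  The lead's files `…TameCellIVLocalTwoTorsion`, `…TameCellIVstarLocalTwoTorsion`,
`…TameCellIVstarPadicNormalForm` proved E-imc-75 modulo ONE input: the existence, for a tame-cell curve with `ord₂(Δ_min) = 8`,
of the Tate `IV*`-normal form over `ℤ₂`.  THIS FILE supplies it from the tree's Tate-algorithm library and closes E-imc-75:

* `a₃_not_mem_maximalIdeal_pow_three_of_IVstarNormalForm` — in residue characteristic `2` the step-8 quadratic
  `Y² + a₃,₂Y − a₆,₄` of the `IV*`-normal form is separable iff `a₃,₂ ≠ 0`, i.e. `a₃ ∉ 𝔪³`;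
* `exists_smul_IVstarNormalForm_of_kodairaSymbolOfMinimal_eq_IVstar` — the tree's normal form
  `LocalIndex.exists_smul_of_kodairaSymbolOfMinimal_eq_IVstar` (steps 2, 6, 8) read in residue characteristic `2`:
  `π ∣ a₁`, `π² ∣ a₂`, `π² ∥ a₃`, `π³ ∣ a₄`, `π⁴ ∣ a₆`;
* `exists_IVstarNormalForm_padicInt` — the same over `ℤ₂` in the shape `[2α, 4α₂, 4α₃ (unit), 8α₄, 16α₆]`;
* `tameCellAtMostOneLocalTwoTorsionPoint_holds` — **E-imc-75 PROVED**: `kodairaSymbolAt_of_four_dvd_conductorNorm` (IV/IV*),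
  `kodairaSymbolAt_eq_padic` (Kodaira symbol of `W ⊗ ℚ₂` over `ℤ₂`), the normal form, and the `2`-adic root analysis
  (`root_unique_of_IVstarCubic_padicInt`; any change of variables over `ℚ₂` permutes the `ℚ₂`-roots).

Nothing about BSD or Manin's conjecture is proved. [cite: SilvermanATAEC1994, IV.9.4 (steps 2, 6, 8) and Table 4.1]
-/

set_option autoImplicit false
set_option linter.dupNamespace false

noncomputable section

open scoped Classical
open Polynomial IsLocalRing WeierstrassCurve
open IsDiscreteValuationRing hiding maximalIdeal
open Literature.NumberTheory.DiophantineGeometry Literature.NumberTheory.DiophantineGeometry.TateAlgorithm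

namespace Summit.BirchSwinnertonDyer.BirchSwinnertonDyer.Theorems.ManinLocalTwoThree

/-! ### §1 The `IV*`-normal form over a DVR of residue characteristic `2` -/

section DVR

variable {R : Type*} [CommRing R] [IsDomain R] [IsDiscreteValuationRing R]

/-- In residue characteristic `2` (`2 ∈ 𝔪`): if `a₃ ∈ 𝔪²`, `a₆ ∈ 𝔪⁴` and the step-8 quadratic `Y² + a₃,₂ Y − a₆,₄` has two
distinct roots in `k̄`, then `a₃ ∉ 𝔪³` (its discriminant is `a₃,₂²` in characteristic `2`).
[cite: SilvermanATAEC1994, IV.9.4 Step 8] -/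
theorem a₃_not_mem_maximalIdeal_pow_three_of_IVstarNormalForm (h2 : (2 : R) ∈ maximalIdeal R)
    (J : WeierstrassCurve R) (h3 : J.a₃ ∈ maximalIdeal R ^ 2) (h6 : J.a₆ ∈ maximalIdeal R ^ 4)
    (h8 : distinctRootCount (quadraticStep8 J) = 2) : J.a₃ ∉ maximalIdeal R ^ 3 := by
  classical
  have hϖ : Irreducible (uniformizer R) := irreducible_uniformizer
  obtain ⟨γ, hγ⟩ := (mem_maximalIdeal_pow_iff_dvd_of_irreducible hϖ _ _).mp h3
  obtain ⟨w, hw⟩ := (mem_maximalIdeal_pow_iff_dvd_of_irreducible hϖ _ _).mp h6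
  have hQ : quadraticStep8 J = X ^ 2 + C (residue R γ) * X - C (residue R w) := by
    simp only [quadraticStep8, hγ, hw, redCoeff_uniformizer_pow_mul]
  have hres2 : residue R (2 : R) = 0 := (residue_eq_zero_iff _).mpr h2
  have h4 : (4 : ResidueField R) = 0 := by
    rw [← map_ofNat (residue R) 4, show (4 : R) = 2 * 2 by norm_num, map_mul, hres2, mul_zero]
  have hγ0 : residue R γ ≠ 0 := by
    intro h0
    rw [hQ, distinctRootCount_sq_add_sub_eq_two_iff] at h8
    apply h8
    rw [h0, h4]; ring
  intro h3'
  obtain ⟨γ', hγ'⟩ := (mem_maximalIdeal_pow_iff_dvd_of_irreducible hϖ _ _).mp h3'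
  have hdiv : uniformizer R ∣ γ := by
    refine ⟨γ', mul_left_cancel₀ (pow_ne_zero 2 hϖ.ne_zero) ?_⟩
    rw [← hγ, hγ']; ring
  exact hγ0 ((residue_eq_zero_iff _).mpr ((mem_maximalIdeal_iff_dvd_of_irreducible hϖ _).mpr hdiv))

/-- **The Tate `IV*`-normal form (residue characteristic `2`).**  Over a DVR with perfect residue field and `2 ∈ 𝔪`: if
Tate's algorithm returns `IV*` on `V`, then for some change of variables `D` over `R` the model `D • V` has
`a₁ ∈ 𝔪`, `a₂ ∈ 𝔪²`, `a₃ ∈ 𝔪² ∖ 𝔪³`, `a₄ ∈ 𝔪³`, `a₆ ∈ 𝔪⁴` (the tree's `LocalIndex.exists_smul_of_kodairaSymbolOfMinimal_eq_IVstar`,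
Silverman ATAEC IV.9.4 steps 2, 6, 8, plus `a₃_not_mem_maximalIdeal_pow_three_of_IVstarNormalForm`).
[cite: SilvermanATAEC1994, IV.9.4 (steps 2, 6, 8)] -/
theorem exists_smul_IVstarNormalForm_of_kodairaSymbolOfMinimal_eq_IVstar [PerfectField (ResidueField R)]
    (h2 : (2 : R) ∈ maximalIdeal R) (V : WeierstrassCurve R) (hV : V.kodairaSymbolOfMinimal = .IVstar) :
    ∃ D : WeierstrassCurve.VariableChange R,
      (D • V).a₁ ∈ maximalIdeal R ∧ (D • V).a₂ ∈ maximalIdeal R ^ 2 ∧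
      (D • V).a₃ ∈ maximalIdeal R ^ 2 ∧ (D • V).a₃ ∉ maximalIdeal R ^ 3 ∧
      (D • V).a₄ ∈ maximalIdeal R ^ 3 ∧ (D • V).a₆ ∈ maximalIdeal R ^ 4 := by
  obtain ⟨D, h1, h2', h3, h4, h6, h8⟩ :=
    Literature.NumberTheory.EllipticCurves.LocalIndex.exists_smul_of_kodairaSymbolOfMinimal_eq_IVstar V hV
  exact ⟨D, h1, h2', h3, a₃_not_mem_maximalIdeal_pow_three_of_IVstarNormalForm h2 _ h3 h6 h8, h4, h6⟩

end DVR

/-! ### §2 The `IV*`-normal form over `ℤ₂` -/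

/-- Over `ℤ₂`: `kodairaSymbolOfMinimal V = IV*` ⟹ a change of variables over `ℤ₂` to `[2α, 4α₂, 4α₃, 8α₄, 16α₆]` with
`α₃ ∈ ℤ₂ˣ`. [cite: SilvermanATAEC1994, IV.9.4 (steps 2, 6, 8)] -/
theorem exists_IVstarNormalForm_padicInt (V : WeierstrassCurve ℤ_[2]) (hV : V.kodairaSymbolOfMinimal = .IVstar) :
    ∃ (D : WeierstrassCurve.VariableChange ℤ_[2]) (α α₂ α₃ α₄ α₆ : ℤ_[2]),
      (D • V).a₁ = 2 * α ∧ (D • V).a₂ = 4 * α₂ ∧ (D • V).a₃ = 4 * α₃ ∧ IsUnit α₃ ∧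
      (D • V).a₄ = 8 * α₄ ∧ (D • V).a₆ = 16 * α₆ := by
  haveI : Finite (ResidueField ℤ_[2]) := Finite.of_equiv _ (PadicInt.residueField (p := 2)).toEquiv.symm
  have h2 : (2 : ℤ_[2]) ∈ maximalIdeal ℤ_[2] := by
    rw [PadicInt.maximalIdeal_eq_span_p]; exact_mod_cast Ideal.mem_span_singleton_self (2 : ℤ_[2])
  have hirr : Irreducible (2 : ℤ_[2]) := by exact_mod_cast PadicInt.irreducible_p (p := 2)
  obtain ⟨D, h1, h2', h3, h3', h4, h6⟩ := exists_smul_IVstarNormalForm_of_kodairaSymbolOfMinimal_eq_IVstar h2 V hV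
  obtain ⟨α, hα⟩ := (mem_maximalIdeal_iff_dvd_of_irreducible hirr _).mp h1
  obtain ⟨α₂, hα₂⟩ := (mem_maximalIdeal_pow_iff_dvd_of_irreducible hirr _ _).mp h2'
  obtain ⟨α₃, hα₃⟩ := (mem_maximalIdeal_pow_iff_dvd_of_irreducible hirr _ _).mp h3
  obtain ⟨α₄, hα₄⟩ := (mem_maximalIdeal_pow_iff_dvd_of_irreducible hirr _ _).mp h4
  obtain ⟨α₆, hα₆⟩ := (mem_maximalIdeal_pow_iff_dvd_of_irreducible hirr _ _).mp h6
  have hα₃u : IsUnit α₃ := by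
    by_contra hnu
    obtain ⟨β, hβ⟩ := padicInt_two_eq_two_mul_of_not_isUnit hnu
    exact h3' ((mem_maximalIdeal_pow_iff_dvd_of_irreducible hirr _ _).mpr ⟨β, by rw [hα₃, hβ]; ring⟩)
  refine ⟨D, α, α₂, α₃, α₄, α₆, ?_, ?_, ?_, hα₃u, ?_, ?_⟩
  · rw [hα]
  · rw [hα₂]; ring
  · rw [hα₃]; ring
  · rw [hα₄]; ring
  · rw [hα₆]; ring

/-! ### §3 Any change of variables over `ℚ₂` permutes the `ℚ₂`-roots of the 2-division polynomial -/

/-- `x ↦ u⁻²(x − r)` carries roots of the 2-division polynomial of `W₂` to those of `C • W₂`. [folklore] -/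
theorem twoDivision_root_smul (W₂ : WeierstrassCurve ℚ_[2]) (C : WeierstrassCurve.VariableChange ℚ_[2]) {x : ℚ_[2]}
    (hx : 4 * x ^ 3 + W₂.b₂ * x ^ 2 + 2 * W₂.b₄ * x + W₂.b₆ = 0) :
    4 * ((C.u⁻¹ : ℚ_[2]ˣ) ^ 2 * (x - C.r)) ^ 3 + (C • W₂).b₂ * ((C.u⁻¹ : ℚ_[2]ˣ) ^ 2 * (x - C.r)) ^ 2 +
      2 * (C • W₂).b₄ * ((C.u⁻¹ : ℚ_[2]ˣ) ^ 2 * (x - C.r)) + (C • W₂).b₆ = 0 := by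
  rw [variableChange_b₂, variableChange_b₄, variableChange_b₆]
  simp only [Units.val_inv_eq_inv_val]
  linear_combination ((C.u : ℚ_[2]))⁻¹ ^ 6 * hx

/-! ### §4 E-imc-75 is a theorem -/

/-- **E-imc-75 `TameCellAtMostOneLocalTwoTorsionPoint` (cell bsd-f2-manin, imc g14; census 215 648 / 215 648), PROVED.**
On the tame cell `4 ∥ N_W` the 2-division polynomial of a globally minimal `W/ℚ` has at most one root in `ℚ₂`: the `IV` cell by
parity of the discriminant (`isLocalTwoTorsionX_unique_of_padicValInt_minimalDiscriminantInt_eq_four`), the `IV*` cell by the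
Tate `IV*`-normal form over `ℤ₂` (`kodairaSymbolAt_eq_padic`, `exists_IVstarNormalForm_padicInt`) and the `2`-adic root analysis
`root_unique_of_IVstarCubic_padicInt`.  Nothing about BSD or Manin's conjecture is proved.
[cite: SilvermanATAEC1994, IV.9.4 and Table 4.1] -/
theorem tameCellAtMostOneLocalTwoTorsionPoint_holds :
    Summit.BirchSwinnertonDyer.Rank1Residual.ManinAdditive.TameTwoLocal.TameCellAtMostOneLocalTwoTorsionPoint := by
  refine tameCellAtMostOneLocalTwoTorsionPoint_of_IVstar ?_
  intro W _ _ h4 h8 hΔ8 x y hx hy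
  -- Kodaira `IV*` at the place of `ℤ` above `2`
  set v : IsDedekindDomain.HeightOneSpectrum ℤ := (Rat.HeightOneSpectrum.primesEquiv (R := ℤ)).symm ⟨2, Nat.prime_two⟩
    with hvdef
  have hv : Rat.HeightOneSpectrum.natGenerator v = 2 :=
    Literature.NumberTheory.EllipticCurves.Rat.natGenerator_primesEquiv_symm ⟨2, Nat.prime_two⟩
  have hK : W.kodairaSymbolAt v = .IVstar := by
    rcases W.kodairaSymbolAt_of_four_dvd_conductorNorm v hv h4 h8 with ⟨-, h⟩ | ⟨h, -⟩
    · rw [hΔ8] at h; norm_num at h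
    · exact h
  -- read over `ℤ₂`
  have e : Rat.HeightOneSpectrum.primesEquiv (R := ℤ) v = ⟨2, Nat.prime_two⟩ := Equiv.apply_symm_apply _ _
  have hKp := WeierstrassCurve.kodairaSymbolAt_eq_padic (R := ℤ) v W
  rw [e] at hKp
  change W.kodairaSymbolAt v = (((W.baseChange ℚ_[2]).minimal ℤ_[2]).integralModel ℤ_[2]).kodairaSymbolOfMinimal at hKp
  rw [hK] at hKp
  set X : WeierstrassCurve ℚ_[2] := W.baseChange ℚ_[2] with hX
  set V₀ : WeierstrassCurve ℤ_[2] := (X.minimal ℤ_[2]).integralModel ℤ_[2] with hV₀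
  obtain ⟨D, α, α₂, α₃, α₄, α₆, h₁, h₂, h₃, hα₃, h₄', h₆⟩ := exists_IVstarNormalForm_padicInt V₀ hKp.symm
  -- the total change of variables over `ℚ₂`
  set E : WeierstrassCurve.VariableChange ℚ_[2] := (X.exists_isMinimal ℤ_[2]).choose with hE
  have hmin : X.minimal ℤ_[2] = E • X := rfl
  have hV₀X : V₀.baseChange ℚ_[2] = X.minimal ℤ_[2] := WeierstrassCurve.baseChange_integralModel_eq ℤ_[2] _
  set Ctot : WeierstrassCurve.VariableChange ℚ_[2] := D.map (algebraMap ℤ_[2] ℚ_[2]) * E with hCtot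
  have hCX : Ctot • X = (D • V₀).map (algebraMap ℤ_[2] ℚ_[2]) := by
    rw [hCtot, mul_smul, ← hmin, ← hV₀X]
    exact WeierstrassCurve.map_variableChange _ _ _
  -- the roots
  have hrat : ∀ q : ℚ, algebraMap ℚ ℚ_[2] q = (q : ℚ_[2]) := fun q => by rw [eq_ratCast]
  have hW : ∀ {t : ℚ_[2]}, Summit.BirchSwinnertonDyer.Rank1Residual.ManinAdditive.TameTwoLocal.IsLocalTwoTorsionX W t →
      4 * t ^ 3 + X.b₂ * t ^ 2 + 2 * X.b₄ * t + X.b₆ = 0 := by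
    intro t ht
    unfold Summit.BirchSwinnertonDyer.Rank1Residual.ManinAdditive.TameTwoLocal.IsLocalTwoTorsionX at ht
    rw [hX, WeierstrassCurve.baseChange, map_b₂, map_b₄, map_b₆, hrat, hrat, hrat]; exact ht
  have halg : algebraMap ℤ_[2] ℚ_[2] = PadicInt.Coe.ringHom := rfl
  have hroot : ∀ {t : ℚ_[2]}, Summit.BirchSwinnertonDyer.Rank1Residual.ManinAdditive.TameTwoLocal.IsLocalTwoTorsionX W t →
      ((Ctot.u⁻¹ : ℚ_[2]ˣ) ^ 2 * (t - Ctot.r)) ^ 3 +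
        ((α ^ 2 + 4 * α₂ : ℤ_[2]) : ℚ_[2]) * ((Ctot.u⁻¹ : ℚ_[2]ˣ) ^ 2 * (t - Ctot.r)) ^ 2 +
        ((4 * (2 * α₄ + α * α₃) : ℤ_[2]) : ℚ_[2]) * ((Ctot.u⁻¹ : ℚ_[2]ˣ) ^ 2 * (t - Ctot.r)) +
        ((4 * (α₃ ^ 2 + 4 * α₆) : ℤ_[2]) : ℚ_[2]) = 0 := by
    intro t ht
    have h := twoDivision_root_smul X Ctot (hW ht)
    rw [hCX, halg] at h
    exact IVstarCubic_eq_zero_of_twoDivision_root (D • V₀) h₁ h₂ h₃ h₄' h₆ h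
  have hxy := root_unique_of_IVstarCubic_padicInt hα₃ (hroot hx) (hroot hy)
  have hu0 : (((Ctot.u⁻¹ : ℚ_[2]ˣ) : ℚ_[2])) ^ 2 ≠ 0 := pow_ne_zero _ (Units.ne_zero _)
  have := mul_left_cancel₀ hu0 hxy
  simpa using this

end Summit.BirchSwinnertonDyer.BirchSwinnertonDyer.Theorems.ManinLocalTwoThree

end
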